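import Literature.Analysis.FluidPDE.TaoCascadeZeroScaleEarly
import Literature.Analysis.FluidPDE.TaoCascadeZeroScaleInit
import HarnessLib

/-!
# Tao's cascade ODE, §6.7: the quiescent phase — small `c₀` keeps `d₀, a₁` small and `a₀ ≈ 1` ((6.149)–(6.151), (6.155)–(6.156))

T. Tao, *Finite time blowup for an averaged three-dimensional Navier–Stokes equation*,
J. Amer. Math. Soc. **29** (2016), 601–674 = arXiv:1402.0290v3, §6.7: while `|c₀| ≤ C_max` on
`[0, T]` (before `t_c`, where `C_max = K^{-10}ε²`, (6.153); or on `[0, 1/2]` by (6.148)), the rotor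
`ε⁻²c₀` is slow, so by (6.149)–(6.150)/(6.155) `|d₀|, |a₁| = O(K^{-10})`, by (6.150)/(6.156)
`a₀ = 1 + O(K⁻⁹)` (in particular `a₀ ≥ 0`), and then by (6.151) `Ẽ₋₁` varies by `O(K^{-14})` —
which is what rules out the exits (6.126)–(6.127) up to such times ((6.151): "`T₂ ≥ 1/2`").

Over `RescaledHypotheses γ …` and pointwise regime bounds on `[0, T]`, this file chains
`zero_da_sqrt_le`, `zero_a_sub_le`, `neg_one_energy_le`, `integral_a_one_sq_le`
(`TaoCascadeZeroScalePhase.lean`) with the initial values (`TaoCascadeZeroScaleInit.lean`) into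
uniform bounds with explicit constants: `quiet_da_le`, `quiet_a_sub_one_le`, `quiet_a_nonneg`,
`quiet_neg_one_energy_le`, `quiet_integral_a_one_sq_le`. No parameter hierarchy is imposed; the
smallness needed for `a₀ ≥ 0` enters as the explicit hypothesis `drift · T ≤ 1`.

## References

* T. Tao, J. Amer. Math. Soc. 29 (2016), 601–674, arXiv:1402.0290v3, §6.7 (6.149)–(6.151),
  (6.155)–(6.156). [`Tao2016AveragedNS`]
-/

noncomputable section

open Set MeasureTheory intervalIntegral

namespace Literature.Analysis.FluidPDE

namespace TaoCascade

open Literature.Analysis.ODE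

section Quiet

variable {γ ε₀ K ε C₁ C₂ C₃ : ℝ} {n₀ N : ℤ} {τ : ℤ → ℝ} {Xr : Fin 4 → ℤ → ℝ → ℝ} {Er : ℤ → ℝ → ℝ}

/-- **(6.149)/(6.155): `d₀, a₁` stay small while `|c₀| ≤ C_max`.** On `[0, T]` (`0 ≤ T`) with the
regime bounds and `|c₀| ≤ C_max` there:
`√(d₀²+a₁²)(t) ≤ e^{νT}(K^{-10} + √2K^{-15} + (ε⁻²√2 C_max + η₂ + η₃)T)` with
`ν = (1+ε₀)^{5/2}(εB_b + ε²e^{-K^{10}}B_c)`, `η₂ = C₁(1+ε₀)^{-n₀/2}`,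
`η₃ = (1+ε₀)^{5/2}ε⁻²B_cB_d + C₁(1+ε₀)^{2-n₀/2}`; the same bound holds for `|d₀(t)|` and `|a₁(t)|`.
[cite: Tao2016AveragedNS, §6.7 (6.149), (6.155)] -/
theorem RescaledHypotheses.quiet_da_le
    (h : RescaledHypotheses γ ε₀ K ε C₁ C₂ C₃ n₀ N τ Xr Er) (hε : 0 < ε) (hC₁ : 0 ≤ C₁)
    (hε₀ : 0 < ε₀) (hK : 0 < K) (hN : n₀ ≤ N) {T Bb Bc Bd Cmax : ℝ} (hT : 0 ≤ T)
    (hreg : ∀ t ∈ Icc 0 T, Er 0 t ≤ 1 ∧ Er 1 t ≤ 1)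
    (hsec : ∀ t ∈ Icc 0 T, |Xr 1 1 t| ≤ Bb ∧ |Xr 2 1 t| ≤ Bc ∧ |Xr 3 1 t| ≤ Bd)
    (hc : ∀ t ∈ Icc 0 T, |Xr 2 0 t| ≤ Cmax) {t : ℝ} (ht : t ∈ Icc 0 T) :
    Real.sqrt (Xr 3 0 t ^ 2 + Xr 0 1 t ^ 2) ≤
      Real.exp ((1 + ε₀) ^ ((5 : ℝ) / 2) * (ε * Bb + ε ^ 2 * Real.exp (-K ^ 10) * Bc) * T) *
        ((K ^ 10)⁻¹ + Real.sqrt 2 * (K ^ 15)⁻¹ +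
          ((ε ^ 2)⁻¹ * Real.sqrt 2 * Cmax + C₁ * (1 + ε₀) ^ (-((n₀ : ℝ) / 2)) +
            ((1 + ε₀) ^ ((5 : ℝ) / 2) * (ε ^ 2)⁻¹ * Bc * Bd + C₁ * (1 + ε₀) ^ (2 - (n₀ : ℝ) / 2))) * T) := by
  have hτ0 : τ (n₀ - N) ≤ 0 := h.tau_le _ le_rfl (by omega)
  have hq0 : (0 : ℝ) < 1 + ε₀ := by linarith
  have hbase := h.zero_da_sqrt_le hε hC₁ hε₀ hτ0 hreg hsec ht
  rw [sub_zero] at hbase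
  have hBb : 0 ≤ Bb := (abs_nonneg _).trans (hsec 0 ⟨le_rfl, hT⟩).1
  have hBc : 0 ≤ Bc := (abs_nonneg _).trans (hsec 0 ⟨le_rfl, hT⟩).2.1
  have hBd : 0 ≤ Bd := (abs_nonneg _).trans (hsec 0 ⟨le_rfl, hT⟩).2.2
  have hCmax : 0 ≤ Cmax := (abs_nonneg _).trans (hc 0 ⟨le_rfl, hT⟩)
  have hν : 0 ≤ (1 + ε₀) ^ ((5 : ℝ) / 2) * (ε * Bb + ε ^ 2 * Real.exp (-K ^ 10) * Bc) := by
    have := Real.rpow_nonneg hq0.le ((5 : ℝ) / 2); positivity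
  have hη : 0 ≤ C₁ * (1 + ε₀) ^ (-((n₀ : ℝ) / 2)) := mul_nonneg hC₁ (Real.rpow_nonneg hq0.le _)
  have hη₃ : 0 ≤ (1 + ε₀) ^ ((5 : ℝ) / 2) * (ε ^ 2)⁻¹ * Bc * Bd + C₁ * (1 + ε₀) ^ (2 - (n₀ : ℝ) / 2) := by
    have := Real.rpow_nonneg hq0.le ((5 : ℝ) / 2)
    have := mul_nonneg hC₁ (Real.rpow_nonneg hq0.le (2 - (n₀ : ℝ) / 2))
    positivity
  set R : ℝ := (ε ^ 2)⁻¹ * Real.sqrt 2 * Cmax + C₁ * (1 + ε₀) ^ (-((n₀ : ℝ) / 2)) +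
    ((1 + ε₀) ^ ((5 : ℝ) / 2) * (ε ^ 2)⁻¹ * Bc * Bd + C₁ * (1 + ε₀) ^ (2 - (n₀ : ℝ) / 2)) with hR
  have hR0 : 0 ≤ R := by rw [hR]; positivity
  -- the integral of the forcing is at most `R t ≤ R T`
  have hint : ∫ s in (0 : ℝ)..t, ((ε ^ 2)⁻¹ * Real.sqrt 2 * |Xr 2 0 s| + C₁ * (1 + ε₀) ^ (-((n₀ : ℝ) / 2)) +
      ((1 + ε₀) ^ ((5 : ℝ) / 2) * (ε ^ 2)⁻¹ * Bc * Bd + C₁ * (1 + ε₀) ^ (2 - (n₀ : ℝ) / 2))) ≤ R * T := by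
    have hcont : ContinuousOn (fun s => (ε ^ 2)⁻¹ * Real.sqrt 2 * |Xr 2 0 s| +
        C₁ * (1 + ε₀) ^ (-((n₀ : ℝ) / 2)) +
        ((1 + ε₀) ^ ((5 : ℝ) / 2) * (ε ^ 2)⁻¹ * Bc * Bd + C₁ * (1 + ε₀) ^ (2 - (n₀ : ℝ) / 2)))
        (Icc 0 t) :=
      ((continuousOn_const.mul (h.continuousOn_X 2 0 hτ0).abs).add continuousOn_const).add
        continuousOn_const
    have hgi : IntervalIntegrable (fun _ : ℝ => R) volume 0 t := continuous_const.intervalIntegrable _ _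
    have h1 := integral_mono_on ht.1 (hcont.intervalIntegrable_of_Icc ht.1) hgi (fun s hs => by
        have := hc s ⟨hs.1, hs.2.trans ht.2⟩
        show _ ≤ R
        rw [hR]
        have h0 : 0 ≤ (ε ^ 2)⁻¹ * Real.sqrt 2 := by positivity
        nlinarith)
    have h2 : ∫ s in (0 : ℝ)..t, (fun _ : ℝ => R) s = R * t := by
      simp only [intervalIntegral.integral_const, smul_eq_mul]; ring
    have h3 : R * t ≤ R * T := mul_le_mul_of_nonneg_left ht.2 hR0
    linarith
  have hinit := h.sqrt_da_zero_le hε₀ hK hN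
  have hexp : Real.exp ((1 + ε₀) ^ ((5 : ℝ) / 2) * (ε * Bb + ε ^ 2 * Real.exp (-K ^ 10) * Bc) * t) ≤
      Real.exp ((1 + ε₀) ^ ((5 : ℝ) / 2) * (ε * Bb + ε ^ 2 * Real.exp (-K ^ 10) * Bc) * T) :=
    Real.exp_le_exp.2 (mul_le_mul_of_nonneg_left ht.2 hν)
  calc Real.sqrt (Xr 3 0 t ^ 2 + Xr 0 1 t ^ 2) ≤ _ := hbase
    _ ≤ Real.exp ((1 + ε₀) ^ ((5 : ℝ) / 2) * (ε * Bb + ε ^ 2 * Real.exp (-K ^ 10) * Bc) * t) *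
        ((K ^ 10)⁻¹ + Real.sqrt 2 * (K ^ 15)⁻¹ + R * T) := by
        apply mul_le_mul_of_nonneg_left _ (Real.exp_pos _).le
        linarith
    _ ≤ _ := by
        apply mul_le_mul_of_nonneg_right hexp
        have : 0 ≤ (K ^ 10)⁻¹ + Real.sqrt 2 * (K ^ 15)⁻¹ := by positivity
        nlinarith

/-- `|d₀|` and `|a₁|` are bounded by `√(d₀²+a₁²)`. [folklore] -/
theorem abs_le_sqrt_sq_add_sq (x y : ℝ) : |x| ≤ Real.sqrt (x ^ 2 + y ^ 2) ∧ |y| ≤ Real.sqrt (x ^ 2 + y ^ 2) := by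
  constructor
  · rw [← Real.sqrt_sq_eq_abs]; exact Real.sqrt_le_sqrt (by nlinarith)
  · rw [← Real.sqrt_sq_eq_abs]; exact Real.sqrt_le_sqrt (by nlinarith)

/-- **(6.150)/(6.156): `a₀` stays near `1`.** On `[0, T]` (`0 ≤ T`) with `Ẽ₀ ≤ 1`, `Ẽ₋₁ ≤ E₋`,
`|c₀| ≤ C_max`, `|d₀| ≤ D_max`: `|a₀(t) - 1| ≤ drift · T` with
`drift = ε⁻²C_maxD_max + 2ε + 2ε²e^{-K^{10}} + 2KE₋ + C₁(1+ε₀)^{-n₀/2}`; in particular `a₀(t) ≥ 0`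
as soon as `drift · T ≤ 1`. [cite: Tao2016AveragedNS, §6.7 (6.150), (6.156)] -/
theorem RescaledHypotheses.quiet_a_sub_one_le
    (h : RescaledHypotheses γ ε₀ K ε C₁ C₂ C₃ n₀ N τ Xr Er) (hε : 0 < ε) (hK : 0 ≤ K) (hC₁ : 0 ≤ C₁)
    (hε₀ : 0 < ε₀) (hN : n₀ ≤ N) {T Em Cmax Dmax : ℝ} (hT : 0 ≤ T)
    (hreg : ∀ t ∈ Icc 0 T, Er 0 t ≤ 1 ∧ Er (-1) t ≤ Em)
    (hcd : ∀ t ∈ Icc 0 T, |Xr 2 0 t| ≤ Cmax ∧ |Xr 3 0 t| ≤ Dmax) {t : ℝ} (ht : t ∈ Icc 0 T) :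
    |Xr 0 0 t - 1| ≤
        ((ε ^ 2)⁻¹ * Cmax * Dmax +
          (2 * ε + 2 * ε ^ 2 * Real.exp (-K ^ 10) + 2 * K * Em + C₁ * (1 + ε₀) ^ (-((n₀ : ℝ) / 2)))) * T ∧
      (((ε ^ 2)⁻¹ * Cmax * Dmax +
          (2 * ε + 2 * ε ^ 2 * Real.exp (-K ^ 10) + 2 * K * Em + C₁ * (1 + ε₀) ^ (-((n₀ : ℝ) / 2)))) * T ≤
          1 → 0 ≤ Xr 0 0 t) := by
  have hτ0 : τ (n₀ - N) ≤ 0 := h.tau_le _ le_rfl (by omega)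
  have hq0 : (0 : ℝ) < 1 + ε₀ := by linarith
  have hb := h.zero_a_sub_le hε hK hC₁ hε₀ hτ0 hreg hcd ht
  rw [h.a_eq, sub_zero] at hb
  have hCmax : 0 ≤ Cmax := (abs_nonneg _).trans (hcd 0 ⟨le_rfl, hT⟩).1
  have hDmax : 0 ≤ Dmax := (abs_nonneg _).trans (hcd 0 ⟨le_rfl, hT⟩).2
  have hEm : 0 ≤ Em := le_trans (h.nonneg_F (-1) 0 hτ0) (hreg 0 ⟨le_rfl, hT⟩).2
  have hdrift : 0 ≤ (ε ^ 2)⁻¹ * Cmax * Dmax +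
      (2 * ε + 2 * ε ^ 2 * Real.exp (-K ^ 10) + 2 * K * Em + C₁ * (1 + ε₀) ^ (-((n₀ : ℝ) / 2))) := by
    have := mul_nonneg hC₁ (Real.rpow_nonneg hq0.le (-((n₀ : ℝ) / 2)))
    positivity
  have h1 : |Xr 0 0 t - 1| ≤ _ * T := hb.trans (mul_le_mul_of_nonneg_left ht.2 hdrift)
  refine ⟨h1, fun hsmall => ?_⟩
  have := (abs_le.mp h1).1
  linarith

/-- **(6.151): `Ẽ₋₁` exits slowly during the quiescent phase.** On `[0, T]` with `Ẽ₋₁ ≤ E₁`,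
`Ẽ₋₂ ≤ E₂`, `a₀ ≥ 0` there: `Ẽ₋₁(t) ≤ Ẽ₋₁(0) + 2K(1+ε₀)^{-5/2}E₂√(2E₁)·T` (`0 ≤ T`, `K ≥ 0`).
[cite: Tao2016AveragedNS, §6.7 (6.151)] -/
theorem RescaledHypotheses.quiet_neg_one_energy_le
    (h : RescaledHypotheses γ ε₀ K ε C₁ C₂ C₃ n₀ N τ Xr Er) (hK : 0 ≤ K) (hε₀ : 0 < ε₀) (hN : n₀ ≤ N)
    {T E₁ E₂ : ℝ} (hT : 0 ≤ T) (hreg : ∀ t ∈ Icc 0 T, Er (-1) t ≤ E₁ ∧ Er (-2) t ≤ E₂)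
    (ha : ∀ t ∈ Icc 0 T, 0 ≤ Xr 0 0 t) {t : ℝ} (ht : t ∈ Icc 0 T) :
    Er (-1) t ≤ Er (-1) 0 + 2 * K * (1 + ε₀) ^ (-((5 : ℝ) / 2)) * E₂ * Real.sqrt (2 * E₁) * T := by
  have hτ0 : τ (n₀ - N) ≤ 0 := h.tau_le _ le_rfl (by omega)
  have hb := h.neg_one_energy_le hK hε₀ hτ0 hreg ha ht
  rw [sub_zero] at hb
  have hE2 : 0 ≤ E₂ := le_trans (h.nonneg_F (-2) 0 hτ0) (hreg 0 ⟨le_rfl, hT⟩).2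
  have hc : 0 ≤ 2 * K * (1 + ε₀) ^ (-((5 : ℝ) / 2)) * E₂ * Real.sqrt (2 * E₁) := by
    have := Real.rpow_nonneg (by linarith : (0 : ℝ) ≤ 1 + ε₀) (-((5 : ℝ) / 2)); positivity
  exact hb.trans (by nlinarith [mul_le_mul_of_nonneg_left ht.2 hc])

end Quiet

end TaoCascade

end Literature.Analysis.FluidPDE
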